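import Literature.Algebra.Polynomial.CasasAlvero.PrimePowSuccCounterexample
import Mathlib.Tactic.NormNum.Prime
import HarnessLib

/-!
# Casas-Alvero in degree 5 fails in characteristics 2, 3, 7, 11 (four of the nine bad primes)

Castryck–Laterveer–Ounaïes (2012, §1; also Chellali–Salinier) list nine bad primes for degree 5.  Characteristic 2 is
`not_holdsInDegree_five_of_char_two` (`5 = 2^2 + 1`, `PrimePowSuccCounterexample.lean`); here explicit prime-field-rational
Casas-Alvero quintics found by exhaustive search over `𝔽_3`, `𝔽_7`, `𝔽_11` settle three more:
* `X^5 + X^4 + X^3` in characteristic 3 (witness roots 0, 0, 1, 1) and in characteristic 7 (witness roots 0, 0, 2, 4);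
* `X^5 + X^3 + 2 X^2` in characteristic 11 (witness roots 0, -1, -1, 0).
(The search found NO `𝔽_13`-rational example, consistent with 13 not being a bad prime; the remaining bad primes 131, 193, 599,
3541, 8009 are `Degree5CharPLarge.lean` / `Degree5Char3541.lean`, and the positive statement in every other characteristic is
`Degree5.lean`.  ERRATUM: earlier revisions of this docstring listed `1451` in place of `3541`; the ninth bad prime of degree 5 in
[CastryckLaterveerOunaies2012, Thm. 4] is `3541` — `1451` is not a bad prime, `CA_5` HOLDS in characteristic `1451`
(`holdsInDegree_five_of_charP`).) [cite: CastryckLaterveerOunaies2012, Sec. 1]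
-/

noncomputable section

open Polynomial

namespace Literature.Algebra.Polynomial.CasasAlvero

variable (K : Type*) [Field K]

/-- degree bookkeeping for `X^5 + X^4 + X^3`. [folklore] -/
theorem natDegree_quintic₁ : ((X : K[X]) ^ 5 + X ^ 4 + X ^ 3).natDegree = 5 := by
  have h54 : ((X : K[X]) ^ 5 + X ^ 4).natDegree = 5 := by
    rw [natDegree_add_eq_left_of_natDegree_lt] <;> simp
  rw [natDegree_add_eq_left_of_natDegree_lt] <;> simp [h54]

/-- `X^5 + X^4 + X^3` is monic. [folklore] -/
theorem monic_quintic₁ : ((X : K[X]) ^ 5 + X ^ 4 + X ^ 3).Monic := by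
  have h54m : ((X : K[X]) ^ 5 + X ^ 4).Monic := by
    apply Monic.add_of_left (monic_X_pow _)
    rw [degree_X_pow, degree_X_pow]; exact_mod_cast (by norm_num : (4 : ℕ) < 5)
  have h54 : ((X : K[X]) ^ 5 + X ^ 4).natDegree = 5 := by
    rw [natDegree_add_eq_left_of_natDegree_lt] <;> simp
  apply h54m.add_of_left
  rw [degree_X_pow, degree_eq_natDegree h54m.ne_zero, h54]
  exact_mod_cast (by norm_num : (3 : ℕ) < 5)

/-- If `X^5 + X^4 + X^3 = (X - a)^5` over a field then `a = 0` (evaluate at 0), which is absurd unless `3 = 1`… used below. [folklore] -/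
theorem eq_zero_of_quintic₁_eq_pow {a : K} (ha : (X : K[X]) ^ 5 + X ^ 4 + X ^ 3 = (X - C a) ^ 5) : a = 0 := by
  have h0 := congrArg (eval 0) ha
  simp only [eval_add, eval_pow, eval_X, eval_sub, eval_C, zero_sub] at h0
  norm_num at h0
  have := (pow_eq_zero_iff (by norm_num : 5 ≠ 0)).mp h0.symm
  exact neg_eq_zero.mp this

section Char3
variable [CharP K 3]

/-- `X^5 + X^4 + X^3` is Casas-Alvero in characteristic 3. [cite: CastryckLaterveerOunaies2012, Sec. 1] -/
theorem isCasasAlvero_quintic_char_three : IsCasasAlvero ((X : K[X]) ^ 5 + X ^ 4 + X ^ 3) := by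
  have h3 : (3 : K) = 0 := by simpa using CharP.cast_eq_zero K 3
  intro i hi0 hi
  rw [natDegree_quintic₁] at hi
  interval_cases i
  · refine ⟨0, by simp, ?_⟩
    simp only [map_add, hasseDeriv_X_pow, eval_add, eval_mul, eval_C, eval_pow, eval_X]
    norm_num
  · refine ⟨0, by simp, ?_⟩
    simp only [map_add, hasseDeriv_X_pow, eval_add, eval_mul, eval_C, eval_pow, eval_X,
      show Nat.choose 3 2 = 3 from rfl]
    norm_num
  · refine ⟨1, ?_, ?_⟩
    · simp only [eval_add, eval_pow, eval_X, one_pow]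
      linear_combination h3
    · simp only [map_add, hasseDeriv_X_pow, eval_add, eval_mul, eval_C, eval_pow, eval_X, one_pow, mul_one,
        show Nat.choose 5 3 = 10 from rfl, show Nat.choose 4 3 = 4 from rfl, show Nat.choose 3 3 = 1 from rfl]
      push_cast
      linear_combination (5 : K) * h3
  · refine ⟨1, ?_, ?_⟩
    · simp only [eval_add, eval_pow, eval_X, one_pow]
      linear_combination h3
    · simp only [map_add, hasseDeriv_X_pow, eval_add, eval_mul, eval_C, eval_pow, eval_X, one_pow, mul_one,
        show Nat.choose 5 4 = 5 from rfl, show Nat.choose 4 4 = 1 from rfl, show Nat.choose 3 4 = 0 from rfl]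
      push_cast
      linear_combination (2 : K) * h3

/-- CA₅ FAILS in characteristic 3. [cite: CastryckLaterveerOunaies2012, Sec. 1] -/
theorem not_holdsInDegree_five_of_char_three : ¬ HoldsInDegree K 5 := by
  have h3 : (3 : K) = 0 := by simpa using CharP.cast_eq_zero K 3
  intro h
  obtain ⟨a, ha⟩ := h _ (monic_quintic₁ K) (natDegree_quintic₁ K) (isCasasAlvero_quintic_char_three K)
  have ha0 := eq_zero_of_quintic₁_eq_pow K ha
  subst ha0
  have h1 := congrArg (eval 1) ha
  simp only [eval_add, eval_pow, eval_X, map_zero, sub_zero, one_pow] at h1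
  exact one_ne_zero (by linear_combination (-1 : K) * h1 + h3 : (1 : K) = 0)

end Char3

section Char7
variable [CharP K 7]

/-- `X^5 + X^4 + X^3` is Casas-Alvero in characteristic 7 as well (witness roots 0, 0, 2, 4). [cite: CastryckLaterveerOunaies2012, Sec. 1] -/
theorem isCasasAlvero_quintic_char_seven : IsCasasAlvero ((X : K[X]) ^ 5 + X ^ 4 + X ^ 3) := by
  have h7 : (7 : K) = 0 := by simpa using CharP.cast_eq_zero K 7
  intro i hi0 hi
  rw [natDegree_quintic₁] at hi
  interval_cases i
  · refine ⟨0, by simp, ?_⟩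
    simp only [map_add, hasseDeriv_X_pow, eval_add, eval_mul, eval_C, eval_pow, eval_X]
    norm_num
  · refine ⟨0, by simp, ?_⟩
    simp only [map_add, hasseDeriv_X_pow, eval_add, eval_mul, eval_C, eval_pow, eval_X,
      show Nat.choose 3 2 = 3 from rfl]
    norm_num
  · refine ⟨2, ?_, ?_⟩
    · simp only [eval_add, eval_pow, eval_X]
      linear_combination (8 : K) * h7
    · simp only [map_add, hasseDeriv_X_pow, eval_add, eval_mul, eval_C, eval_pow, eval_X,
        show Nat.choose 5 3 = 10 from rfl, show Nat.choose 4 3 = 4 from rfl, show Nat.choose 3 3 = 1 from rfl]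
      push_cast
      linear_combination (7 : K) * h7
  · refine ⟨4, ?_, ?_⟩
    · simp only [eval_add, eval_pow, eval_X]
      linear_combination (192 : K) * h7
    · simp only [map_add, hasseDeriv_X_pow, eval_add, eval_mul, eval_C, eval_pow, eval_X,
        show Nat.choose 5 4 = 5 from rfl, show Nat.choose 4 4 = 1 from rfl, show Nat.choose 3 4 = 0 from rfl]
      push_cast
      linear_combination (3 : K) * h7

/-- CA₅ FAILS in characteristic 7. [cite: CastryckLaterveerOunaies2012, Sec. 1] -/
theorem not_holdsInDegree_five_of_char_seven : ¬ HoldsInDegree K 5 := by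
  have h7 : (7 : K) = 0 := by simpa using CharP.cast_eq_zero K 7
  intro h
  obtain ⟨a, ha⟩ := h _ (monic_quintic₁ K) (natDegree_quintic₁ K) (isCasasAlvero_quintic_char_seven K)
  have ha0 := eq_zero_of_quintic₁_eq_pow K ha
  subst ha0
  have h2 := congrArg (eval 2) ha
  simp only [eval_add, eval_pow, eval_X, map_zero, sub_zero] at h2
  exact one_ne_zero (by linear_combination (-2 : K) * h2 + (7 : K) * h7 : (1 : K) = 0)

end Char7

section Char11
variable [CharP K 11]

/-- `X^5 + X^3 + 2X^2` is Casas-Alvero in characteristic 11 (witness roots 0, -1, -1, 0). [cite: CastryckLaterveerOunaies2012, Sec. 1] -/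
theorem isCasasAlvero_quintic_char_eleven : IsCasasAlvero ((X : K[X]) ^ 5 + X ^ 3 + (2 : K) • X ^ 2) := by
  have h11 : (11 : K) = 0 := by simpa using CharP.cast_eq_zero K 11
  have h53 : ((X : K[X]) ^ 5 + X ^ 3).natDegree = 5 := by
    rw [natDegree_add_eq_left_of_natDegree_lt] <;> simp
  have hsm : ((2 : K) • (X : K[X]) ^ 2).natDegree ≤ 2 := (natDegree_smul_le _ _).trans (by simp)
  have hdeg : ((X : K[X]) ^ 5 + X ^ 3 + (2 : K) • X ^ 2).natDegree = 5 := by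
    rw [natDegree_add_eq_left_of_natDegree_lt (by rw [h53]; omega), h53]
  intro i hi0 hi
  rw [hdeg] at hi
  interval_cases i
  · refine ⟨0, by simp, ?_⟩
    simp only [map_add, map_smul, hasseDeriv_X_pow, eval_add, eval_mul, eval_C, eval_pow, eval_X, eval_smul,
      smul_eq_mul, show Nat.choose 2 1 = 2 from rfl]
    norm_num
  · refine ⟨-1, ?_, ?_⟩
    · simp only [eval_add, eval_pow, eval_X, eval_smul, smul_eq_mul]
      ring
    · simp only [map_add, map_smul, hasseDeriv_X_pow, eval_add, eval_mul, eval_C, eval_pow, eval_X, eval_smul,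
        smul_eq_mul, show Nat.choose 5 2 = 10 from rfl, show Nat.choose 3 2 = 3 from rfl, show Nat.choose 2 2 = 1 from rfl]
      push_cast
      linear_combination (-1 : K) * h11
  · refine ⟨-1, ?_, ?_⟩
    · simp only [eval_add, eval_pow, eval_X, eval_smul, smul_eq_mul]
      ring
    · simp only [map_add, map_smul, hasseDeriv_X_pow, eval_add, eval_mul, eval_C, eval_pow, eval_X, eval_smul,
        smul_eq_mul, show Nat.choose 5 3 = 10 from rfl, show Nat.choose 3 3 = 1 from rfl, show Nat.choose 2 3 = 0 from rfl]
      push_cast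
      linear_combination h11
  · refine ⟨0, by simp, ?_⟩
    simp only [map_add, map_smul, hasseDeriv_X_pow, eval_add, eval_mul, eval_C, eval_pow, eval_X, eval_smul,
      smul_eq_mul, show Nat.choose 5 4 = 5 from rfl, show Nat.choose 3 4 = 0 from rfl, show Nat.choose 2 4 = 0 from rfl]
    norm_num

/-- CA₅ FAILS in characteristic 11. [cite: CastryckLaterveerOunaies2012, Sec. 1] -/
theorem not_holdsInDegree_five_of_char_eleven : ¬ HoldsInDegree K 5 := by
  intro h
  have h53 : ((X : K[X]) ^ 5 + X ^ 3).natDegree = 5 := by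
    rw [natDegree_add_eq_left_of_natDegree_lt] <;> simp
  have hsm : ((2 : K) • (X : K[X]) ^ 2).natDegree ≤ 2 := (natDegree_smul_le _ _).trans (by simp)
  have hdeg : ((X : K[X]) ^ 5 + X ^ 3 + (2 : K) • X ^ 2).natDegree = 5 := by
    rw [natDegree_add_eq_left_of_natDegree_lt (by rw [h53]; omega), h53]
  have h53m : ((X : K[X]) ^ 5 + X ^ 3).Monic := by
    apply Monic.add_of_left (monic_X_pow _)
    rw [degree_X_pow, degree_X_pow]; exact_mod_cast (by norm_num : (3 : ℕ) < 5)
  have hmon : ((X : K[X]) ^ 5 + X ^ 3 + (2 : K) • X ^ 2).Monic := by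
    apply h53m.add_of_left
    refine lt_of_le_of_lt (degree_smul_le _ _) ?_
    rw [degree_X_pow, degree_eq_natDegree h53m.ne_zero, h53]
    exact_mod_cast (by norm_num : (2 : ℕ) < 5)
  obtain ⟨a, ha⟩ := h _ hmon hdeg (isCasasAlvero_quintic_char_eleven K)
  have h0 := congrArg (eval 0) ha
  simp only [eval_add, eval_pow, eval_X, eval_sub, eval_C, zero_sub, eval_smul, smul_eq_mul] at h0
  norm_num at h0
  have ha0 : a = 0 := by
    have := (pow_eq_zero_iff (by norm_num : 5 ≠ 0)).mp h0.symm
    exact neg_eq_zero.mp this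
  subst ha0
  have h1 := congrArg (eval (-1)) ha
  simp only [eval_add, eval_pow, eval_X, map_zero, sub_zero, eval_smul, smul_eq_mul] at h1
  exact one_ne_zero (by linear_combination h1 : (1 : K) = 0)

end Char11

end Literature.Algebra.Polynomial.CasasAlvero
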